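import Summits.RiemannHypothesis.RiemannHypothesis.Theorems.JensenPolynomialsSkeletonDefs
import Literature.NumberTheory.LFunctions.JensenHermite

/-!
# Route `JensenPolynomials` — rung J-P (P1⁺), support S1: SOUNDNESS of the skeleton sign certificate

**RH-FREE, ξ-free (real polynomials only).** Main theorem `SkeletonCertificate.splits_nodup`: if `Q` has
`d = deg Q = deg P ≥ 2` simple real zeros, `lc P · lc Q > 0`, and `P(e)·Q(e) > 0` at every critical point `e` of `Q`,
then `P` has `d` simple real zeros (`P.Splits ∧ P.roots.Nodup`). This is support statement S1 of the theory seat's P1⁺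
blueprint (HOME `rh-jensen-theory/JensenTargets.lean` §2, `THEORY-JENSEN.md` §5): it is what turns the CAL's / the DATA
engine's cell-by-cell sign certificates (`SkeletonSignTest`, DATA §9, ET7) into hyperbolicity in the kernel.

Proof (classical, Rolle + IVT; the tree's `Interlaces.step` / `hermiteSignTestSound_holds` pattern with an arbitrary
hyperbolic skeleton in place of the Hermite one): sort the zeros `x₀ < ⋯ < x_{d−1}` of `Q`
(`exists_strictMono_roots`); Rolle gives a critical point of `Q` in each gap, and `P·Q → +∞` at `±∞` gives one test point
below `x₀` and one above `x_{d−1}`; at these `d + 1` points `P·Q > 0` while the sign of `Q` alternates (product formula,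
tree `sign_prod_sub`), so `P` alternates; `d` sign changes of a degree-`d` polynomial give `d` simple real zeros
(tree `exists_roots_of_alternating`, `splits_of_roots`). Nothing here bears on the truth of RH.
-/

noncomputable section
-- D-0017: `Summit.RiemannHypothesis.RiemannHypothesis.…` duplicates the namespace BY DESIGN (single-problem summit).
set_option linter.dupNamespace false

namespace Summit.RiemannHypothesis.RiemannHypothesis.Theorems.JensenPolynomials

open Literature.NumberTheory.LFunctions Polynomial Finset Filter
open scoped BigOperators Nat Topology

/-! ## Sorted simple zeros and the product formula -/

/-- A real polynomial that splits with simple zeros and has degree `d` has a strictly increasing enumeration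
`x : Fin d → ℝ` of its zeros, and `Q(t) = lc(Q) · ∏ᵢ (t − xᵢ)`. [folklore] -/
theorem exists_strictMono_roots {Q : ℝ[X]} {d : ℕ} (hs : Q.Splits) (hnd : Q.roots.Nodup)
    (hdeg : Q.natDegree = d) :
    ∃ x : Fin d → ℝ, StrictMono x ∧ ∀ t : ℝ, Q.eval t = Q.leadingCoeff * ∏ i, (t - x i) := by
  classical
  have hcard : Q.roots.card = Q.natDegree := splits_iff_card_roots.mp hs
  set S : Finset ℝ := Q.roots.toFinset with hS
  have hScard : S.card = d := by rw [hS, Multiset.toFinset_card_of_nodup hnd, hcard, hdeg]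
  refine ⟨fun i => S.orderEmbOfFin hScard i, (S.orderEmbOfFin hScard).strictMono, fun t => ?_⟩
  have hroots : Q.roots = (Finset.univ : Finset (Fin d)).val.map fun i => S.orderEmbOfFin hScard i := by
    have h1 : Q.roots = S.val := by rw [hS, Multiset.toFinset_val, hnd.dedup]
    have h2 : (Finset.map (S.orderEmbOfFin hScard).toEmbedding Finset.univ).val = S.val := by
      rw [Finset.map_orderEmbOfFin_univ]
    rw [h1, ← h2, Finset.map_val]
    rfl
  have hprod := C_leadingCoeff_mul_prod_multiset_X_sub_C hcard
  conv_lhs => rw [← hprod]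
  rw [eval_mul, eval_C, eval_multiset_prod, Multiset.map_map, hroots, Multiset.map_map,
    Finset.prod_eq_multiset_prod]
  simp [Function.comp_def]

/-- Consecutive brackets give opposite signs of the product `∏ᵢ (t − xᵢ)`: if exactly the indices `≥ j` exceed `u`
and exactly the indices `≥ j + 1` exceed `v`, then `(∏ (u − xᵢ))·(∏ (v − xᵢ)) < 0`. [folklore] -/
theorem prod_sub_mul_prod_sub_neg {d : ℕ} (x : Fin d → ℝ) (u v : ℝ) (j : ℕ) (hj : j + 1 ≤ d)
    (hu1 : ∀ i : Fin d, (i : ℕ) < j → x i < u) (hu2 : ∀ i : Fin d, j ≤ (i : ℕ) → u < x i)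
    (hv1 : ∀ i : Fin d, (i : ℕ) < j + 1 → x i < v) (hv2 : ∀ i : Fin d, j + 1 ≤ (i : ℕ) → v < x i) :
    (∏ i, (u - x i)) * ∏ i, (v - x i) < 0 := by
  have h1 := sign_prod_sub x u j (by omega) hu1 hu2
  have h2 := sign_prod_sub x v (j + 1) hj hv1 hv2
  rw [show d + (j + 1) = (d + j) + 1 by ring, pow_succ] at h2
  rcases neg_one_pow_eq_or ℝ (d + j) with h | h
  · rw [h] at h1 h2
    nlinarith
  · rw [h] at h1 h2
    nlinarith

/-! ## S1: soundness of the skeleton sign certificate -/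

/-- **S1 (RH-FREE, ξ-free): soundness of the skeleton sign certificate.** If `Q` has `deg Q = deg P ≥ 2` simple real
zeros, the leading coefficients of `P`, `Q` have the same sign, and `P(e)·Q(e) > 0` at every critical point `e` of `Q`,
then `P` splits over `ℝ` with simple zeros. (HOME `JensenTargets` §2 `SkeletonCertificateSound`; THEORY-JENSEN §5 S1.) -/
theorem SkeletonCertificate.splits_nodup {P Q : ℝ[X]} (h : SkeletonCertificate P Q) :
    P.Splits ∧ P.roots.Nodup := by
  classical
  obtain ⟨hdegPQ, h2, hlc, hQs, hQnd, hsame⟩ := h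
  set d := Q.natDegree with hd
  obtain ⟨x, hx, hQeval⟩ := exists_strictMono_roots hQs hQnd hd.symm
  have hQne : Q ≠ 0 := by
    intro h0; rw [h0, leadingCoeff_zero, mul_zero] at hlc; exact lt_irrefl _ hlc
  have hPne : P ≠ 0 := by
    intro h0; rw [h0, leadingCoeff_zero, zero_mul] at hlc; exact lt_irrefl _ hlc
  have hlcQ : Q.leadingCoeff ≠ 0 := leadingCoeff_ne_zero.mpr hQne
  have hQroot : ∀ i : Fin d, Q.eval (x i) = 0 := fun i => by
    rw [hQeval]
    exact mul_eq_zero_of_right _ (Finset.prod_eq_zero (Finset.mem_univ i) (sub_self _))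
  -- the product `P·Q`: even degree `2d ≥ 4`, positive leading coefficient, so `→ +∞` at both ends
  have hPQdeg : (P * Q).natDegree = 2 * d := by rw [natDegree_mul hPne hQne, hdegPQ, ← hd]; ring
  have hPQlc : (P * Q).leadingCoeff = P.leadingCoeff * Q.leadingCoeff := leadingCoeff_mul P Q
  have hPQne : P * Q ≠ 0 := mul_ne_zero hPne hQne
  have hd0 : 0 < d := by omega
  have htop : Tendsto (fun t => (P * Q).eval t) atTop atTop :=
    (P * Q).tendsto_atTop_of_leadingCoeff_nonneg
      (by rw [degree_eq_natDegree hPQne, hPQdeg]; exact_mod_cast (by omega : 0 < 2 * d))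
      (by rw [hPQlc]; exact hlc.le)
  have hbot : Tendsto (fun t => (P * Q).eval (-t)) atTop atTop := by
    set S := (P * Q).comp (-X) with hS
    have hSlead : S.leadingCoeff = P.leadingCoeff * Q.leadingCoeff := by
      rw [hS, comp_neg_X_leadingCoeff_eq, hPQdeg, hPQlc, pow_mul, neg_one_sq, one_pow, one_mul]
    have hSdeg : S.natDegree = 2 * d := by rw [hS, natDegree_comp, hPQdeg]; simp
    have hSne : S ≠ 0 := by
      intro h0; rw [h0, leadingCoeff_zero] at hSlead; rw [← hSlead] at hlc; exact lt_irrefl _ hlc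
    have ht : Tendsto (fun t => S.eval t) atTop atTop :=
      S.tendsto_atTop_of_leadingCoeff_nonneg
        (by rw [degree_eq_natDegree hSne, hSdeg]; exact_mod_cast (by omega : 0 < 2 * d))
        (by rw [hSlead]; exact hlc.le)
    refine ht.congr fun t => ?_
    simp [hS, eval_comp]
  -- for every `j ≤ d`, a test point bracketed by exactly the zeros with index `≥ j` above it, where `P·Q > 0`
  have key : ∀ j : Fin (d + 1), ∃ u : ℝ, (∀ i : Fin d, (i : ℕ) < (j : ℕ) → x i < u) ∧
      (∀ i : Fin d, (j : ℕ) ≤ (i : ℕ) → u < x i) ∧ 0 < P.eval u * Q.eval u := by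
    intro j
    by_cases hj0 : (j : ℕ) = 0
    · -- below every zero
      obtain ⟨y, hy1, hy2⟩ :=
        ((hbot.eventually_gt_atTop 0).and (eventually_gt_atTop (-x ⟨0, hd0⟩))).exists
      refine ⟨-y, fun i hi => absurd hi (by omega), fun i _ => ?_, by simpa [eval_mul] using hy1⟩
      have : x ⟨0, hd0⟩ ≤ x i := hx.monotone (Fin.mk_le_mk.mpr (Nat.zero_le _))
      linarith
    by_cases hjd : (j : ℕ) = d
    · -- above every zero
      obtain ⟨y, hy1, hy2⟩ :=
        ((htop.eventually_gt_atTop 0).and (eventually_gt_atTop (x ⟨d - 1, by omega⟩))).exists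
      refine ⟨y, fun i _ => ?_, fun i hi => absurd hi (by omega), by simpa [eval_mul] using hy1⟩
      have : x i ≤ x ⟨d - 1, by omega⟩ := hx.monotone (Fin.mk_le_mk.mpr (by omega))
      linarith
    · -- a critical point of `Q` strictly between `x_{j-1}` and `x_j` (Rolle)
      have hj1 : (j : ℕ) - 1 < d := by omega
      have hj2 : (j : ℕ) < d := by omega
      have hab : x ⟨(j : ℕ) - 1, hj1⟩ < x ⟨(j : ℕ), hj2⟩ := hx (Fin.mk_lt_mk.mpr (by omega))
      obtain ⟨e, he, hde⟩ := exists_deriv_eq_zero (f := fun t => Q.eval t) hab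
        Q.continuous.continuousOn (by rw [hQroot, hQroot])
      rw [Polynomial.deriv] at hde
      refine ⟨e, fun i hi => ?_, fun i hi => ?_, hsame e hde⟩
      · have : x i ≤ x ⟨(j : ℕ) - 1, hj1⟩ := hx.monotone (Fin.mk_le_mk.mpr (by omega))
        exact this.trans_lt he.1
      · have : x ⟨(j : ℕ), hj2⟩ ≤ x i := hx.monotone (Fin.mk_le_mk.mpr (by omega))
        exact he.2.trans_le this
  choose u hul hur hPQ using key
  -- `P` changes sign between consecutive test points
  have hstep : ∀ i : Fin d, u i.castSucc < u i.succ ∧ P.eval (u i.castSucc) * P.eval (u i.succ) < 0 := by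
    intro i
    have hlt : u i.castSucc < u i.succ :=
      (hur i.castSucc i (by simp)).trans (hul i.succ i (by simp))
    refine ⟨hlt, ?_⟩
    have hprod : (∏ k, (u i.castSucc - x k)) * ∏ k, (u i.succ - x k) < 0 :=
      prod_sub_mul_prod_sub_neg x (u i.castSucc) (u i.succ) i (by omega)
        (fun k hk => hul i.castSucc k (by simpa using hk)) (fun k hk => hur i.castSucc k (by simpa using hk))
        (fun k hk => hul i.succ k (by simpa using hk)) (fun k hk => hur i.succ k (by simpa using hk))
    have hQQ : Q.eval (u i.castSucc) * Q.eval (u i.succ) < 0 := by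
      rw [hQeval, hQeval]
      have hlc2 : 0 < Q.leadingCoeff ^ 2 := by positivity
      nlinarith
    have hpos : 0 < (P.eval (u i.castSucc) * P.eval (u i.succ)) * (Q.eval (u i.castSucc) * Q.eval (u i.succ)) := by
      have := mul_pos (hPQ i.castSucc) (hPQ i.succ)
      linarith [this]
    exact neg_of_mul_pos_left hpos hQQ.le
  have hu : StrictMono u := by
    rw [Fin.strictMono_iff_lt_succ]
    exact fun i => (hstep i).1
  obtain ⟨t, ht, -, hroot⟩ := exists_roots_of_alternating P u hu fun i => (hstep i).2
  have hdegP : P.natDegree ≤ d := by rw [hdegPQ]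
  obtain ⟨hPs, -, hProots⟩ := splits_of_roots hPne hdegP t ht.injective hroot
  exact ⟨hPs, hProots ▸ Multiset.Nodup.map ht.injective Finset.univ.nodup⟩

/-- S1 in the words of the blueprint: every `SkeletonCertificate` certifies hyperbolicity with simple zeros
(`∀ P Q, SkeletonCertificate P Q → P.Splits ∧ P.roots.Nodup`). RH-FREE, ξ-free. -/
theorem skeletonCertificate_sound (P Q : ℝ[X]) (h : SkeletonCertificate P Q) : P.Splits ∧ P.roots.Nodup :=
  h.splits_nodup

/-- In particular a certified `P` has exactly `deg P` roots counted in `P.roots` (all real, simple). RH-FREE, ξ-free. -/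
theorem SkeletonCertificate.card_roots {P Q : ℝ[X]} (h : SkeletonCertificate P Q) :
    P.roots.card = P.natDegree :=
  splits_iff_card_roots.mp h.splits_nodup.1

end Summit.RiemannHypothesis.RiemannHypothesis.Theorems.JensenPolynomials

end
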